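import Literature.NumberTheory.EllipticCurves.HeckeUnitRootNotRootOfUnityProofs
import HarnessLib

/-!
# No root of `X² − a_p X + p^{k−1}` has absolute value `p^{k/2}` or `p^{k/2−1}`, for a newform on `Γ₀(M)` of EVEN weight and
# `p ∤ M` — in `ℂ` and in `ℚ̄_p` (proofs only)

Topic `NumberTheory/EllipticCurves` (namespace `Literature.NumberTheory.EllipticCurves.ModularForms`). THEOREMS ONLY (no definition,
no named fact; D-0026). Sequel of `HeckeUnitRootNotRootOfUnityProofs.lean` (no root is a root of unity), by the SAME elementary argument:
if a root `z` of `X² − μX + p^{k−1}` (`μ` an eigenvalue of `T_p` on `S_k(Γ₀(M))`, `p ∤ M`, `k = 2m ≥ 2` even) had `|z| = p^m`, then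
`μ = z + p^{k−1} z̄/p^{2m} = z + z̄/p` is REAL (`conj_eq_of_hasEigenvalue_heckeT`, self-adjointness of `T_p`), so `z = ±p^m` and
`|μ| = p^{m−1}(p + 1)`, i.e. `|μ|² = (p+1)² p^{k−2}` — EXACTLY the value excluded by the STRICT trivial bound `|μ|² < (p+1)² p^{k−2}`
(`norm_sq_lt_of_heckeT_eq_smul`, tree); the case `|z| = p^{m−1}` is the same statement for the other root `μ − z`. (Deligne's theorem
`|z| = p^{(k−1)/2}` is not used.)

* `norm_sq_eq_of_root_of_norm_eq_pow` — `‖z‖ = p^m ⟹ ‖μ‖² = (p+1)² p^{k−2}`.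
* `norm_ne_of_root_heckePolynomial` — complex form: `‖z‖ ≠ p^m` and `‖z‖·p ≠ p^m` (`2m = k ≥ 2`).
* `norm_ringEquiv_ne_of_root_heckePolynomial_padic` — for `ι : K_g → ℚ̄_p`, `α ∈ ℚ̄_p` with `α² − ι(a_p)α + p^{k−1} = 0` and a
  compatible `ι' : ℚ̄_p ≃+* ℂ` (`ι' ∘ ι = (K_g ⊆ ℂ)`): `‖ι' α‖ ≠ p^m` and `‖ι' α‖·p ≠ p^m`.

Use: cell `bsd-stepL`, crux 23253 (the self-dual re-key of 25505), stub (FIX)†: the diagonal characters of the SELF-DUAL twist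
`A_g^† = A_g ⊗ ε^{1−k/2}` at the anticyclotomic local symbol `σ_K` (`ε(σ_K) = π̄²`, `δ(σ_K) = α_p^h`) are `π̄^{k}α_p^{−h}` and
`π̄^{2−k}α_p^{h}`; a root of unity among them would force `|α_p| = p^{k/2}` resp. `p^{k/2−1}` under a compatible `ι'`.

References: [DiamondShurman2005] Prop. 5.2.1, Thm. 5.5.3 (Hecke operators, trivial bound); [Deligne1974] Thm. 8.2 (not used).
-/

noncomputable section

open scoped MatrixGroups ModularForm ComplexConjugate
open CongruenceSubgroup UpperHalfPlane
open Literature.FieldTheory.AlgClosed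

namespace Literature.NumberTheory.EllipticCurves.ModularForms

variable {N : ℕ} [NeZero N] {k : ℤ} {p : ℕ}

/-- **If a root `z` of `X² − μX + p^{k−1}` has `‖z‖ = p^m` (`k = 2m ≥ 2`), then `‖μ‖² = (p+1)² p^{k−2}`** for an eigenvalue `μ` of
`T_p` (`p ∤ N`) on `S_k(Γ₀(N))`: `μ p = z p + z̄` is real, so `z = ±p^m` and `‖μ‖ p = p^m (p+1)`.
[cite: DiamondShurman2005, Thm. 5.5.3 and Prop. 5.2.1] -/
theorem norm_sq_eq_of_root_of_norm_eq_pow [NeZero p] (hp : p.Prime) (hpN : ¬ p ∣ N) (hk : 2 ≤ k)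
    {f : CuspForm (Gamma0 N) k} (hf : f ≠ 0) {μ : ℂ} (hμ : heckeT (Gamma0 N) k p f = μ • f) {z : ℂ} {m : ℕ}
    (hm : ((2 * m : ℕ) : ℤ) = k) (hroot : z ^ 2 - μ * z + (p : ℂ) ^ (k - 1) = 0) (hz : ‖z‖ = (p : ℝ) ^ m) :
    ‖μ‖ ^ 2 = ((p : ℝ) + 1) ^ 2 * (p : ℝ) ^ (k - 2) := by
  have hp0 : (p : ℂ) ≠ 0 := Nat.cast_ne_zero.mpr hp.ne_zero
  have hpR : (0 : ℝ) < p := Nat.cast_pos.mpr hp.pos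
  have hm1 : 1 ≤ m := by omega
  obtain ⟨n, rfl⟩ : ∃ n, m = n + 1 := ⟨m - 1, by omega⟩
  -- `p^{k-1} = p^(n+1) · p^n` and `z z̄ = p^(n+1) p^(n+1)`
  have hk1 : (p : ℂ) ^ (k - 1) = (p : ℂ) ^ (n + 1) * (p : ℂ) ^ n := by
    rw [← pow_add, ← zpow_natCast]; congr 1; push_cast; omega
  have hzz : z * conj z = (p : ℂ) ^ (n + 1) * (p : ℂ) ^ (n + 1) := by
    rw [Complex.mul_conj, Complex.normSq_eq_norm_sq, hz]; push_cast; ring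
  have hz0 : z ≠ 0 := by
    intro h0; rw [h0, norm_zero] at hz; exact (pow_pos hpR _).ne hz
  -- `μ p = z p + z̄`
  have hμz : μ * (p : ℂ) = z * (p : ℂ) + conj z := by
    have h1 : μ * z = z ^ 2 + (p : ℂ) ^ (k - 1) := by linear_combination -hroot
    have h3 : (μ * (p : ℂ) - (z * (p : ℂ) + conj z)) * z = 0 := by
      have e : μ * z * (p : ℂ) = z * z * (p : ℂ) + (p : ℂ) ^ (n + 1) * (p : ℂ) ^ n * (p : ℂ) := by
        rw [h1, hk1]; ring
      rw [show (p : ℂ) ^ (n + 1) * (p : ℂ) ^ n * (p : ℂ) = (p : ℂ) ^ (n + 1) * (p : ℂ) ^ (n + 1) by ring, ← hzz] at e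
      linear_combination e
    rcases mul_eq_zero.mp h3 with h | h
    · exact sub_eq_zero.mp h
    · exact absurd h hz0
  -- `μ` real ⟹ `z` real
  have hreal : conj μ = μ :=
    conj_eq_of_hasEigenvalue_heckeT hp hpN (Module.End.hasEigenvalue_of_hasEigenvector ⟨Module.End.mem_eigenspace_iff.mpr hμ, hf⟩)
  have hzreal : conj z = z := by
    have h := congrArg conj hμz
    rw [map_mul, map_add, map_mul, Complex.conj_conj, map_natCast, hreal, hμz] at h
    have h' : ((p : ℂ) - 1) * (z - conj z) = 0 := by linear_combination h
    rcases mul_eq_zero.mp h' with h'' | h''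
    · exfalso
      have : (p : ℂ) = 1 := by linear_combination h''
      exact hp.one_lt.ne' (by exact_mod_cast this)
    · exact (sub_eq_zero.mp h'').symm
  -- so `μ p = z (p + 1)` and `‖μ‖ p = p^m (p + 1)`
  have hμ' : μ * (p : ℂ) = z * ((p : ℂ) + 1) := by rw [hμz, hzreal]; ring
  have hnorm : ‖μ‖ * (p : ℝ) = (p : ℝ) ^ (n + 1) * ((p : ℝ) + 1) := by
    have h := congrArg norm hμ'
    rw [norm_mul, norm_mul, hz, Complex.norm_natCast] at h
    rw [h]; congr 1; exact_mod_cast Complex.norm_natCast (p + 1)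
  -- `‖μ‖² p² = p^{2(n+1)} (p+1)² = (p+1)² p^{k-2} p²`
  have hk2 : (p : ℝ) ^ (k - 2) * (p : ℝ) ^ 2 = ((p : ℝ) ^ (n + 1)) ^ 2 := by
    rw [← zpow_natCast (p : ℝ) 2, ← zpow_add₀ hpR.ne', ← pow_mul, ← zpow_natCast]; congr 1; push_cast; omega
  have key : ‖μ‖ ^ 2 * (p : ℝ) ^ 2 = ((p : ℝ) + 1) ^ 2 * (p : ℝ) ^ (k - 2) * (p : ℝ) ^ 2 := by
    rw [mul_assoc, hk2, ← mul_pow, hnorm]; ring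
  exact mul_right_cancel₀ (pow_ne_zero 2 hpR.ne') key

/-- **No root of `X² − μX + p^{k−1}` has `‖z‖ = p^{k/2}` or `‖z‖ = p^{k/2−1}`** (`k = 2m ≥ 2` even, `μ` an eigenvalue of `T_p` on
`S_k(Γ₀(N))`, `p ∤ N`): both would give `‖μ‖² = (p+1)² p^{k−2}`, against the STRICT trivial bound `norm_sq_lt_of_heckeT_eq_smul`; the
second case is the first for the other root `μ − z`. [cite: DiamondShurman2005, Thm. 5.5.3 and Prop. 5.2.1] -/
theorem norm_ne_of_root_heckePolynomial [NeZero p] (hp : p.Prime) (hpN : ¬ p ∣ N) (hk : 2 ≤ k) {f : CuspForm (Gamma0 N) k}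
    (hf : f ≠ 0) {μ : ℂ} (hμ : heckeT (Gamma0 N) k p f = μ • f) {z : ℂ} {m : ℕ} (hm : ((2 * m : ℕ) : ℤ) = k)
    (hroot : z ^ 2 - μ * z + (p : ℂ) ^ (k - 1) = 0) :
    ‖z‖ ≠ (p : ℝ) ^ m ∧ ‖z‖ * p ≠ (p : ℝ) ^ m := by
  have hlt := norm_sq_lt_of_heckeT_eq_smul hp hpN hf hμ
  have hpR : (0 : ℝ) < p := Nat.cast_pos.mpr hp.pos
  refine ⟨fun hz ↦ absurd (norm_sq_eq_of_root_of_norm_eq_pow hp hpN hk hf hμ hm hroot hz) hlt.ne, fun hz ↦ ?_⟩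
  -- the other root `z' = μ − z` has `z z' = p^{k−1}` and `‖z'‖ = p^m`
  have hm1 : 1 ≤ m := by omega
  have hroot' : (μ - z) ^ 2 - μ * (μ - z) + (p : ℂ) ^ (k - 1) = 0 := by linear_combination hroot
  have hzz' : z * (μ - z) = (p : ℂ) ^ (k - 1) := by linear_combination -hroot
  have hn : ‖z‖ * ‖μ - z‖ = (p : ℝ) ^ (k - 1) := by
    rw [← norm_mul, hzz', norm_zpow, Complex.norm_natCast]
  have h1 : ‖z‖ = (p : ℝ) ^ (m - 1) := by
    have : (p : ℝ) ^ m = (p : ℝ) ^ (m - 1) * p := by rw [← pow_succ]; congr 1; omega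
    rw [this] at hz
    exact mul_right_cancel₀ hpR.ne' hz
  have h2 : (p : ℝ) ^ (k - 1) = (p : ℝ) ^ (m - 1) * (p : ℝ) ^ m := by
    rw [← pow_add, ← zpow_natCast]; congr 1; push_cast; omega
  rw [h1, h2] at hn
  have hz' : ‖μ - z‖ = (p : ℝ) ^ m := mul_left_cancel₀ (pow_ne_zero _ hpR.ne') hn
  exact absurd (norm_sq_eq_of_root_of_norm_eq_pow hp hpN hk hf hμ hm hroot' hz') hlt.ne

variable {M : ℕ} [NeZero M]

/-- **`p`-adic form through a compatible `ι' : ℚ̄_p ≃ ℂ`.** For a newform `g ∈ S_k(Γ₀(M))` of even weight `k = 2m ≥ 2`, `p ∤ M`,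
`ι : K_g → ℚ̄_p`, a root `α ∈ ℚ̄_p` of `X² − ι(a_p)X + p^{k−1}` and a field isomorphism `ι' : ℚ̄_p ≃+* ℂ` with `ι' ∘ ι = (K_g ⊆ ℂ)`:
`‖ι' α‖ ≠ p^m` and `‖ι' α‖·p ≠ p^m` (`ι' α` is a root of `X² − a_p X + p^{k−1}` for the eigenvalue `a_p` of `T_p`,
`IsNewform0.heckeT_eq_coeff_smul`). [cite: DiamondShurman2005, Thm. 5.5.3 and Prop. 5.2.1] -/
theorem norm_ringEquiv_ne_of_root_heckePolynomial_padic {g : CuspForm (Gamma0 M) k} (hg : IsNewform0 g) (hk : 2 ≤ k)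
    {p : ℕ} [Fact p.Prime] (hpM : ¬ p ∣ M) (ι : coeffField g →+* PadicAlgCl p) {α : PadicAlgCl p}
    (hα : α ^ 2 - ι ⟨(qExpansion 1 ⇑g).coeff p, coeff_mem_coeffField g p⟩ * α + (p : PadicAlgCl p) ^ (k - 1) = 0)
    {m : ℕ} (hm : ((2 * m : ℕ) : ℤ) = k) (ι' : PadicAlgCl p ≃+* ℂ) (hι' : ∀ x, ι' (ι x) = (x : ℂ)) :
    ‖ι' α‖ ≠ (p : ℝ) ^ m ∧ ‖ι' α‖ * p ≠ (p : ℝ) ^ m := by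
  have hp : p.Prime := Fact.out
  haveI : NeZero p := ⟨hp.ne_zero⟩
  have hg0 : g ≠ 0 := by
    intro h0
    have h1 : IsNormalized g := hg.2.2
    rw [IsNormalized, h0] at h1
    simp [UpperHalfPlane.qExpansion_zero] at h1
  have hμ : heckeT (Gamma0 M) k p g = (qExpansion 1 ⇑g).coeff p • g := IsNewform0.heckeT_eq_coeff_smul hg hp
  have hroot : (ι' α) ^ 2 - (qExpansion 1 ⇑g).coeff p * ι' α + (p : ℂ) ^ (k - 1) = 0 := by
    have h := congrArg ι' hα
    rw [map_zero, map_add, map_sub, map_pow, map_mul, hι', map_zpow₀, map_natCast] at h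
    exact h
  exact norm_ne_of_root_heckePolynomial hp hpM hk hg0 hμ hm hroot

end Literature.NumberTheory.EllipticCurves.ModularForms

end
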